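import Mathlib
import Summits.ValiantsHypothesis.ValiantsHypothesis.Theorems.ValuativeGCTValuativeFlipRayFromBottom
import HarnessLib

/-!
# `ValuativeGCT.ValuativeFlip` (stmt-ValiantsHypothesis-12624): rays from the bottom, V —
# the bottom level `m = n` in the conventions of the siege stubs (all points, no column condition)

Wall-breaker k4 (gen 1, seat 2; axis "representation-stability transfer between `m` and `m + 1`"),
helper file `--supports stmt-ValiantsHypothesis-12624`.  Parts III–IV are stated for a general base level
`m ≥ n` with COLUMN-NORMALISED points (`n < m → A·X₀₀ = X_top`).  At the bottom `m = n` that condition is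
vacuous, and this file restates the identity and its two main corollaries with the point family of k12's
`stub_twistedInheritance` / k16's ray files: ALL matrices `A ∈ Mat_{n²}` acting on `per_n = paddedPerFormLex n n`,
shapes `μ ⊢ n·δ` (`≤ n²` parts, `μ₂ ≤ n`), levels `n + j`.

* `orbitMultiplicity_rowLift_add_finrank_twistKer_self` —
  `mult_{(μ♯(n+j))*} ℂ[Δ_{n+j}(X₀₀^j per_n)] + dim {G ∈ HWV_{μ*} : G(Δ_j(A·per_n)) = 0 ∀ A} = a_μ(δ[n])`, every `j`.
* `orbitMultiplicity_le_rowLift_iff_self` — BLMW Problem 6.10 at padding `j` on the ray of `μ` iff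
  `dim K_j(μ) ≤ dim K_0(μ)` (untwisted kernel `= HWV_{μ*} ∩ I(Δ_n(per_n))`).

(Twisted inheritance with arbitrary points at `m = n` is k12's `stub_twistedInheritance`; its column-normalised
form for every base level is Part IV's `le_orbitMultiplicity_rowLift_of_twistedDet_ne_zero`.)

[BLMW 2011 §6.4; this crux, Parts I–III]
-/

set_option linter.dupNamespace false

namespace Summit.ValiantsHypothesis.ValiantsHypothesis.Theorems.ValuativeFlip

open scoped BigOperators
open MvPolynomial
open Literature.NumberTheory.DiophantineGeometry
open Literature.Computability.AlgebraicComplexity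
open Literature.Computability.Complexity

noncomputable section

/-- At the bottom `m = n` the column condition `n < n → …` is vacuous: the conditioned infimum of
kernels is the plain one. [folklore] -/
theorem rs_iInf_vacuous {n : ℕ} (Q : Matrix (MatIdx n) (MatIdx n) ℂ → Prop)
    (K : Matrix (MatIdx n) (MatIdx n) ℂ → Submodule ℂ (MvPolynomial (DegIdx (MatIdx n) n) ℂ)) :
    (⨅ (A : Matrix (MatIdx n) (MatIdx n) ℂ) (_ : n < n → Q A), K A) = ⨅ (A : Matrix (MatIdx n) (MatIdx n) ℂ), K A :=
  iInf_congr fun _ => iInf_pos fun h => (lt_irrefl n h).elim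

/-- **Rays from the bottom at `m = n`, all points.**  For `n ≥ 1`, `μ ⊢ n·δ` with at most `n²` parts and
`μ₂ ≤ n`, and every `j`:
`mult_{(μ♯(n+j))*} ℂ[Δ_{n+j}(X₀₀^j per_n)] + dim {G ∈ HWV_{μ*}(ℂ[Sym^n ℂ^{n²}]) : G(Δ_j(A · per_n)) = 0 ∀ A ∈ Mat_{n²}}
 = a_μ(δ[n])` (`orbitMultiplicity_rowLift_add_finrank_twistKer` at `m = n`, vacuous column condition).
[BLMW 2011 §6.4; this crux, Part III] -/
theorem orbitMultiplicity_rowLift_add_finrank_twistKer_self (n δ : ℕ) [NeZero n] (μ : Nat.Partition (n * δ))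
    (hμ : μ.parts.card ≤ n * n) (h₂ : μ.sortedParts.getD 1 0 ≤ n) (j : ℕ) [NeZero (n + j)] :
    orbitMultiplicity ℂ (paddedPerFormLex ℂ n (n + j)) (n + j) (partitionWeightLex (n + j) (rowLift μ j)) +
      Module.finrank ℂ ↥(highestWeightSpace (coordRep (MatIdx n) ℂ n) (partitionWeightLex n μ) ⊓
        ⨅ (A : Matrix (MatIdx n) (MatIdx n) ℂ),
          LinearMap.ker (aeval (R := ℂ) (S₁ := ℂ) fun e : DegIdx (MatIdx n) n =>
            (((e.1 (topMatIdx n) + j).descFactorial j : ℕ) : ℂ) *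
              coeff e.1 (linSubst (MatIdx n) ℂ A (paddedPerFormLex ℂ n n))).toLinearMap) =
    plethysmCoeff ℂ (MatIdx n) n (partitionWeightLex n μ) := by
  have h := orbitMultiplicity_rowLift_add_finrank_twistKer (le_refl n) μ hμ h₂ j
  rw [rs_iInf_vacuous] at h
  exact h

/-- **The bottom value, all points**: `mult_{μ*} ℂ[Δ_n(per_n)] + dim (HWV_{μ*} ∩ {G : G(A·per_n) = 0 ∀ A}) = a_μ(δ[n])`
for every `μ` (no condition on `μ₂`). [BLMW 2011 §5.2; this crux, Part III] -/
theorem orbitMultiplicity_add_finrank_ker_self (n δ : ℕ) [NeZero n] (μ : Nat.Partition (n * δ)) :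
    orbitMultiplicity ℂ (paddedPerFormLex ℂ n n) n (partitionWeightLex n μ) +
      Module.finrank ℂ ↥(highestWeightSpace (coordRep (MatIdx n) ℂ n) (partitionWeightLex n μ) ⊓
        ⨅ (A : Matrix (MatIdx n) (MatIdx n) ℂ),
          LinearMap.ker (aeval (R := ℂ) (S₁ := ℂ)
            (formCoeff n (linSubst (MatIdx n) ℂ A (paddedPerFormLex ℂ n n)))).toLinearMap) =
    plethysmCoeff ℂ (MatIdx n) n (partitionWeightLex n μ) := by
  have h := orbitMultiplicity_add_finrank_ker_bottom (n := n) μ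
  rw [rs_iInf_vacuous] at h
  exact h

/-- **BLMW Problem 6.10 on the ray of `μ` from the bottom, all points.**  For `μ ⊢ n·δ` (`≤ n²` parts,
`μ₂ ≤ n`): `mult_{μ*} ℂ[Δ_n(per_n)] ≤ mult_{(μ♯(n+j))*} ℂ[Δ_{n+j}(X₀₀^j per_n)]` iff the Δ_j-twisted kernel
at level `n` is at most as large as the untwisted one. [BLMW 2011 §6.4 Problem 6.10; this crux, Part III] -/
theorem orbitMultiplicity_le_rowLift_iff_self (n δ : ℕ) [NeZero n] (μ : Nat.Partition (n * δ))
    (hμ : μ.parts.card ≤ n * n) (h₂ : μ.sortedParts.getD 1 0 ≤ n) (j : ℕ) [NeZero (n + j)] :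
    orbitMultiplicity ℂ (paddedPerFormLex ℂ n n) n (partitionWeightLex n μ) ≤
        orbitMultiplicity ℂ (paddedPerFormLex ℂ n (n + j)) (n + j) (partitionWeightLex (n + j) (rowLift μ j)) ↔
      Module.finrank ℂ ↥(highestWeightSpace (coordRep (MatIdx n) ℂ n) (partitionWeightLex n μ) ⊓
          ⨅ (A : Matrix (MatIdx n) (MatIdx n) ℂ),
            LinearMap.ker (aeval (R := ℂ) (S₁ := ℂ) fun e : DegIdx (MatIdx n) n =>
              (((e.1 (topMatIdx n) + j).descFactorial j : ℕ) : ℂ) *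
                coeff e.1 (linSubst (MatIdx n) ℂ A (paddedPerFormLex ℂ n n))).toLinearMap) ≤
        Module.finrank ℂ ↥(highestWeightSpace (coordRep (MatIdx n) ℂ n) (partitionWeightLex n μ) ⊓
          ⨅ (A : Matrix (MatIdx n) (MatIdx n) ℂ),
            LinearMap.ker (aeval (R := ℂ) (S₁ := ℂ)
              (formCoeff n (linSubst (MatIdx n) ℂ A (paddedPerFormLex ℂ n n)))).toLinearMap) := by
  have h1 := orbitMultiplicity_add_finrank_ker_self n δ μ
  have h2 := orbitMultiplicity_rowLift_add_finrank_twistKer_self n δ μ hμ h₂ j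
  omega

end

end Summit.ValiantsHypothesis.ValiantsHypothesis.Theorems.ValuativeFlip
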